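import Summits.Ventures.Crystal3D.Theorems.StickyWulffConstantGenericWallFloorHRowEndFarDefs
import Summits.Ventures.Crystal3D.Theorems.StickyWulffConstantGenericWallFloorStackWalkDefs
import HarnessLib

/-!
# `HRowEndFarApart κ`: the REPAIRED local input (J-b′) of the LAYER ROWS line — no rising, APART, strongly certified walker state at an h-row END ball
# (crux `GenericWallFloor`, stmt-Ventures-19480, kernel G; replaces `HRowEndFar` of `…HRowEndFarDefs` (p717949), which is FALSE:
#  `not_hRowEndFar`, `…HRowEndFarRefuted` p724034; posted by the machine owner 19480-p2 g14 2026-08-29T14:1xZ)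

HONEST FRAMING. Venture `Summits/Ventures/Crystal3D` (cell `crystal3d-full`), route `route-Ventures-StickyWulffConstant`, helper for the crux
`GenericWallFloor` (stmt-Ventures-19480) / consumer `TextureLiminfV5` (stmt-Ventures-23912).  ONE definition (a named hypothesis, NOT proved here),
its monotonicity in the steepness and its unpacking at an h-row END; standard axioms; F-C1 not moved.

THE POINT.  `HRowEndFar` asked that an h-row END ball `e` (in-plane predecessor `e − F u` h-FULL, own h-dozen not full) carry no strongly certified
state `⟨F′, q, 0⟩` rising by `≥ 3/8` along a vertical for which the row is steep — for EVERY frame `F′`.  That is false (`not_hRowEndFar`): when an fcc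
run sits directly below (or above) the h-layer, the complete ball `z` of `e − F u`'s polar triple certifies the rising arrival `e − z`, with
`F′·Λ₀` the BASAL TWIN of `F·Λ₀` (resp. `F·Λ₀` itself).  The machine never presents such a frame: a stack walker's bottom frames are in-plane states
(excluded at `e` by `not_walkCertified_bottom_of_hFull`), and its PUSHED frames carry Σ3ⁿ-misoriented lattices, never `F·Λ₀` or its basal twin
(`…ChainNoReturn`).  So the input the count consumes is the same statement WITH APARTNESS of `F′·Λ₀` from those two lattices, and with the row
steepness `κ` of the regime made explicit (the owner's exhaustive rigid catalogue has one isolated APART arrival at `cos(F′q, F u) = −1/3`, which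
rises by `0.431 ≥ 3/8` at `κ = √2/2` but only by `0.299 < 3/8` at `κ = 4/5`; R1′ feeds `κ = 4/5`, available whenever `⟪L₁ e₃, e₃⟫² ≤ 0.146`):
* **`HRowEndFarApart κ`** — THE NAMED INPUT (to be certified by interval B&B over `F′ ∈ SO(3)` × slots × {full, caps} against the rigid 14-ball
  h-side, apartness handling the coherent neighbourhoods exactly; or proved);
* `HRowEndFarApart.mono` — a larger steepness is a weaker demand;
* `HRowEndFarApart.not_certified12` — the unpacked form at an h-row END in the machine's variables (`HRowInv` + `hRowStep = none`).
WHAT THIS IS NOT: no proof of `HRowEndFarApart κ` for any `κ`; no count; F-C1 not moved.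
-/

noncomputable section

namespace Summit.Ventures.Crystal3D.Theorems

open Finset
open Literature.MathematicalPhysics.StatisticalMechanics (fccStacking)
open scoped InnerProductSpace

/-- **`HRowEndFarApart κ` — NO RISING APART CERTIFIED WALKER STATE AT AN h-ROW END BALL** (repaired named input (J-b′) of the LAYER ROWS line).
For frames `F, F′` with `F′·Λ₀ ≠ F·Λ₀` and `F′·Λ₀ ≠ (twinFrame F (F e₃))·Λ₀` (the basal twin), an in-plane slot `u`, a slot `q`, a unit vertical `ζ`
with `⟪F u, ζ⟫ ≥ κ` and `⟪F′ q, ζ⟫ ≥ 3/8`, a `1`-separated `X` and a ball `e ∈ X` whose predecessor `e − F u` is in `X` and h-FULL while `e`'s own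
h-dozen is not full: the state `⟨F′, q, 0⟩` is NOT strongly certified at `e`. -/
def HRowEndFarApart (κ : ℝ) : Prop :=
  ∀ (F F' : EuclideanSpace ℝ (Fin 3) ≃ₗᵢ[ℝ] EuclideanSpace ℝ (Fin 3)), ∀ u ∈ fccSlots, u 2 = 0 → ∀ q ∈ fccSlots,
    ∀ ζ : EuclideanSpace ℝ (Fin 3), ‖ζ‖ = 1 → κ ≤ ⟪F u, ζ⟫_ℝ → (3 : ℝ) / 8 ≤ ⟪F' q, ζ⟫_ℝ →
    F' '' fccStacking 1 (Real.sqrt (2 / 3)) ≠ F '' fccStacking 1 (Real.sqrt (2 / 3)) →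
    F' '' fccStacking 1 (Real.sqrt (2 / 3)) ≠
      (twinFrame F (F (EuclideanSpace.single (2 : Fin 3) (1 : ℝ)))) '' fccStacking 1 (Real.sqrt (2 / 3)) →
    ∀ X : Finset (EuclideanSpace ℝ (Fin 3)), (∀ p ∈ X, ∀ p' ∈ X, p ≠ p' → 1 ≤ dist p p') →
    ∀ e ∈ X, e - F u ∈ X → (∀ s ∈ hcpSlots, e - F u + F s ∈ X) → (∃ s ∈ hcpSlots, e + F s ∉ X) →
      ¬ WalkCertified12 X e ⟨F', q, 0⟩

/-- **Monotonicity in the steepness**: a larger `κ` restricts the verticals, so `HRowEndFarApart κ → HRowEndFarApart κ′` for `κ ≤ κ′`. -/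
theorem HRowEndFarApart.mono {κ κ' : ℝ} (hκ : κ ≤ κ') (h : HRowEndFarApart κ) : HRowEndFarApart κ' :=
  fun F F' u hu hu2 q hq ζ hζ hsteep hrise hA hB X hX e he hp hfull hvac =>
    h F F' u hu hu2 q hq ζ hζ (hκ.trans hsteep) hrise hA hB X hX e he hp hfull hvac

/-- **Unpacking at an h-row END** (machine variables): under `HRowEndFarApart κ`, a ball at which the h-row walk of `(F, u)` has arrived (`HRowInv`)
and stops (`hRowStep = none`) carries no strongly certified state `⟨F′, q, 0⟩` with `F′·Λ₀` apart from `F·Λ₀` and its basal twin whose direction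
rises `≥ 3/8` along a unit vertical `ζ` with `⟪F u, ζ⟫ ≥ κ`. -/
theorem HRowEndFarApart.not_certified12 {κ : ℝ} (hJ : HRowEndFarApart κ) {X : Finset (EuclideanSpace ℝ (Fin 3))}
    (hX : ∀ p ∈ X, ∀ p' ∈ X, p ≠ p' → 1 ≤ dist p p')
    {F F' : EuclideanSpace ℝ (Fin 3) ≃ₗᵢ[ℝ] EuclideanSpace ℝ (Fin 3)} {u q ζ y : EuclideanSpace ℝ (Fin 3)}
    (hu : u ∈ fccSlots) (hu2 : u 2 = 0) (hq : q ∈ fccSlots) (hζ : ‖ζ‖ = 1) (hsteep : κ ≤ ⟪F u, ζ⟫_ℝ)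
    (hrise : (3 : ℝ) / 8 ≤ ⟪F' q, ζ⟫_ℝ)
    (hA : F' '' fccStacking 1 (Real.sqrt (2 / 3)) ≠ F '' fccStacking 1 (Real.sqrt (2 / 3)))
    (hB : F' '' fccStacking 1 (Real.sqrt (2 / 3)) ≠
      (twinFrame F (F (EuclideanSpace.single (2 : Fin 3) (1 : ℝ)))) '' fccStacking 1 (Real.sqrt (2 / 3)))
    (hI : HRowInv X F u y) (hstop : hRowStep X F u y = none) :
    ¬ WalkCertified12 X y ⟨F', q, 0⟩ :=
  hJ F F' u hu hu2 q hq ζ hζ hsteep hrise hA hB X hX y hI.1 hI.2.1 hI.2.2 (not_full_of_hRowStep_eq_none F hstop)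

end Summit.Ventures.Crystal3D.Theorems

end
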